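import Summits.BirchSwinnertonDyer.BirchSwinnertonDyer.Theses.CumulativeHeegnerLeopoldt
import Summits.BirchSwinnertonDyer.BirchSwinnertonDyer.Theorems.CumulativeHeegnerLeopoldtCumulativeHeegnerInclusionAtThreeB1OfPrint
import Summits.BirchSwinnertonDyer.BirchSwinnertonDyer.Theorems.CumulativeHeegnerLeopoldtCumulativeHeegnerInclusionAtThreeLineDeterminantAtThree
import Summits.BirchSwinnertonDyer.BirchSwinnertonDyer.Theorems.CumulativeHeegnerLeopoldtCumulativeHeegnerInclusionAtThreeBadPlacesSplitFinite
import Summits.BirchSwinnertonDyer.BirchSwinnertonDyer.Theorems.CumulativeHeegnerLeopoldtCumulativeHeegnerInclusionAtThreeStubThreeSaturation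
import Summits.BirchSwinnertonDyer.BirchSwinnertonDyer.Theorems.UniversalToricDescentAcDualMuZeroCriterion
import Summits.BirchSwinnertonDyer.Rank1Residual.X2.HidaLimitCongruenceAlgebra
import Summits.BirchSwinnertonDyer.Rank1Residual.X11b.AnticyclotomicModuleFinite
import Literature.NumberTheory.EllipticCurves.SkinnerUrban2014.CharacteristicIdealBaseChangeProofs
import HarnessLib

/-!
# Crux K1 `CumulativeHeegnerInclusionAtThree` (stmt-BirchSwinnertonDyer-24198), line `birth`, stub A
# (= crux stmt-BirchSwinnertonDyer-26896 `TemperedHeegnerInclusionAtThree`): the LAYER-TOWER DOOR —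
# A ⟺ «`3^μ · L ∈ Ch·R₀⟦T⟧ + (3^m, ω_m)` for every `m`», K1 ⟸ P ∧ the FITTING layer tower

Width seat bsd-line-chl-k1-p1-w2 g5 (`--supports stmt-BirchSwinnertonDyer-24198`). THEOREMS ONLY: no
definition, no named fact, no `sorry`; A and P stay displayed antecedents; nothing about the existence of
Heegner / Kolyvagin objects at additive `3` is asserted. BSD is not proved by any of this; no summit
statement is proved by this seat.

## Why (a second output format for crux A, next to the lead's index bounds IB / IB_off / IB♮)

The lead lineage reads a Kolyvagin-system argument for A SPECIALISATION BY SPECIALISATION at the interior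
height-one primes `(Q)` of `Λ = ℤ₃⟦T⟧` (files `…SpecialisationValues{,Off,Tempered}`, `…OfIndexBound`,
`…OfTemperedIndexBound`): the research input is an index bound over the rings `S_Q = ℤ₃[y]`, whose residue
fields are in general larger than `𝔽₃` — Galois cohomology with such coefficients is not in the tree
(`Literature/NumberTheory/GaloisCohomology/KolyvaginSystems.lean`, design note «No coefficient ring is
carried», TODO `R = 𝒪/π^m`). The OTHER classical format of Euler/Kolyvagin-system output is LAYER BY LAYER
in the `ℤ₃`-tower `K ⊂ K_1 ⊂ … ⊂ K_∞` with FINITE coefficients: an (equivariant) statement over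
`R_{k,m} = ℤ/3^k[G_m]`, `G_m = Gal(K_m/K)` — a zero-dimensional Gorenstein local ring, the coefficient
generality of Sakamoto's theory already partially typed in the tree — of the shape «the layer-`m` theta
element lies in `Fitt_{R₀[G_m]}(X_m ⊗ R₀)` up to a FIXED power of `3`» (Mazur–Tate / Kurihara /
Kim–Kurihara format; Bertolini–Darmon for Heegner points over ring class fields), followed by control
`X/ω_m X → X_m` and a layer-`m` reciprocity `θ_m ≡ unit · L (mod ω_m)`. Read in `R₀⟦T⟧` (`1 + T ↔ γ`,
`ω_m = (1+T)^{3^m} − 1`, `Fitt` of `X/ω_m X` over `Λ/ω_m` = image of `Fitt_Λ(X)`), the END of such a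
chain is exactly the hypothesis of this file's door:

  (LT)  `∃ μ ∀ m, 3^μ · L ∈ Fitt_Λ(X)·R₀⟦T⟧ + (3^m) + (ω_m)`   (`X = X_{∅,0}(𝔭′)`),

and the door closes it: `(3, T)`-adically `(3^m, ω_m) → 0` (`ω_m ∈ (3, T)^{m+1}`), ideals of the
Noetherian local ring `R₀⟦T⟧` are closed (Krull), and `Fitt_Λ ⊆ Ch_Λ` (Skinner–Urban §3.1.6) — so (LT)
gives A verbatim, and with the print input P (B1 from print + UTD's Greenberg criterion + saturation, the
route-independent modules of line `birth`, as in the lead's `…OfTemperedDomination`) K1. Conversely A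
implies the `Ch`-form of (LT) trivially, so the door is an honest restatement of A, neither weaker nor
stronger (`temperedHeegnerInclusionAtThree_iff_charLayerTower`); the integral (`μ = 0`) `Ch`-form is
equivalent to K1 itself, print-free (`cumulativeHeegnerInclusionAtThree_iff_integralCharLayerTower`).

What (LT) needs and this file does NOT supply (research / port, recorded for the line designers of 26896):
(i) Heegner/CM points of `3`-power conductor on `X₀(N)` at `9 ∣ N` and their layer classes (objects);
(ii) a layer-`m` equivariant Kolyvagin argument over `ℤ/3^k[G_m]` with residually reducible `E[3]` and a
`3`-power loss INDEPENDENT of `m`; (iii) anticyclotomic control at the layers with uniformly bounded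
cokernel; (iv) the layer reciprocity (p-adic Waldspurger / BDP formula at finite-order characters).

## Contents

* §1 Krull doors in any Noetherian ring: `mem_of_forall_mem_sup_pow`, `mem_of_forall_mem_sup_of_le_pow`.
* §2 `ω_m = (1+y)^{p^m} − 1 ∈ I^{m+1}` whenever `p, y ∈ I` (any commutative ring):
  `one_add_pow_sub_one_mem_mul`, `one_add_pow_pow_sub_one_mem_pow`.
* §3 In `R₀⟦T⟧ = UnrSeries p`: `span_C_sup_span_X_le_jacobson`, the layer door
  `mem_of_forall_mem_sup_layer` («`x ∈ J + (p^m, ω_m)` for all `m` ⟹ `x ∈ J`»).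
* §4 BY NAME at K1's frame (`p = 3`): `temperedHeegnerInclusionAtThree_of_charLayerTower`,
  `temperedHeegnerInclusionAtThree_iff_charLayerTower`, `map_fittingIdeal_le_map_charIdeal`,
  `temperedHeegnerInclusionAtThree_of_fittingLayerTower` (**(LT) ⟹ A**),
  `cumulativeHeegnerInclusionAtThree_of_print_of_fittingLayerTower` (**P → (LT) → K1**, route-independent modules),
  `cumulativeHeegnerInclusionAtThree_of_integralCharLayerTower` / `_iff_` (K1 ⟺ integral layer tower).

References: [MazurTate1987] §1 (theta elements in group rings of layers, Fitting ideals); [KimKurihara2021]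
§1 (Fitting ideals of Selmer groups over layer group rings); [BertoliniDarmon1990] (Kolyvagin's descent over
ring class fields); [SkinnerUrban2014] §3.1.6, Cor. 3.2.9 (`Fitt ⊆ Ch`); [StacksProject] Tag 00IP (Krull's
intersection theorem); [Washington1997] §13.2 (`ω_n`, `Λ/ω_n = ℤ_p[G_n]`).
-/

set_option linter.dupNamespace false
set_option autoImplicit false

noncomputable section

open scoped Classical

namespace Summit.BirchSwinnertonDyer.BirchSwinnertonDyer.Theorems.CumulativeHeegnerInclusionAtThreeLayerTower

open Literature.NumberTheory.EllipticCurves NumberField IsDedekindDomain Field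
  Summit.BirchSwinnertonDyer.Rank1Residual.X11b Summit.BirchSwinnertonDyer.Rank1Residual.X11b.AcSelmer
  Summit.BirchSwinnertonDyer.Rank1Residual.X2.HidaLimitAlgebra

universe u

/-! ### §1 Krull doors (any Noetherian ring, any ideal inside the Jacobson radical) -/

section Krull

variable {R : Type u} [CommRing R] [IsNoetherianRing R] {I : Ideal R}

/-- **Krull door.** In a Noetherian ring, if `I ⊆ Jac(R)` and `x ∈ J + I^n` for every `n`, then `x ∈ J`
(ideals are closed in the `I`-adic topology: `⋂_n (J + I^n) = J`, Krull's intersection theorem applied to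
`R/J`). [cite: StacksProject, Tag 00IP] [cite: AtiyahMacdonald1969, Cor. 10.19] -/
theorem mem_of_forall_mem_sup_pow (hI : I ≤ (⊥ : Ideal R).jacobson) (J : Ideal R) {x : R}
    (h : ∀ n : ℕ, x ∈ J ⊔ I ^ n) : x ∈ J := by
  have hx : x ∈ ⨅ n : ℕ, J ⊔ I ^ n := (Submodule.mem_iInf _).mpr h
  rwa [CongruenceLimit.iInf_sup_pow_eq_self I J hI] at hx

/-- **Krull door along a null sequence of ideals.** If `I ⊆ Jac(R)`, the ideals `𝔞_m` tend to zero
`I`-adically (`∀ n ∃ m, 𝔞_m ⊆ I^n`) and `x ∈ J + 𝔞_m` for every `m`, then `x ∈ J`.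
[cite: StacksProject, Tag 00IP] -/
theorem mem_of_forall_mem_sup_of_le_pow (hI : I ≤ (⊥ : Ideal R).jacobson) (J : Ideal R)
    (𝔞 : ℕ → Ideal R) (h𝔞 : ∀ n : ℕ, ∃ m : ℕ, 𝔞 m ≤ I ^ n) {x : R} (h : ∀ m : ℕ, x ∈ J ⊔ 𝔞 m) :
    x ∈ J :=
  mem_of_forall_mem_sup_pow hI J fun n ↦ by
    obtain ⟨m, hm⟩ := h𝔞 n
    exact (sup_le_sup_left hm J) (h m)

/-- Ideal form of the Krull door: `J' ⊆ J + 𝔞_m` for all `m`, `𝔞_m → 0`, `I ⊆ Jac(R)` ⟹ `J' ⊆ J`.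
[cite: StacksProject, Tag 00IP] -/
theorem le_of_forall_le_sup_of_le_pow (hI : I ≤ (⊥ : Ideal R).jacobson) (J J' : Ideal R)
    (𝔞 : ℕ → Ideal R) (h𝔞 : ∀ n : ℕ, ∃ m : ℕ, 𝔞 m ≤ I ^ n) (h : ∀ m : ℕ, J' ≤ J ⊔ 𝔞 m) :
    J' ≤ J :=
  fun _ hx ↦ mem_of_forall_mem_sup_of_le_pow hI J 𝔞 h𝔞 fun m ↦ h m hx

end Krull

/-! ### §2 The layer polynomials `ω_m = (1 + y)^{p^m} − 1` tend to zero `(p, y)`-adically -/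

section Omega

variable {R : Type u} [CommRing R]

/-- `(1 + z)^n − 1 = z · Σ_{i<n} (1+z)^i` and `Σ_{i<n} (1+z)^i ≡ n (mod z)`: if `n ∈ I` and `z ∈ I ∩ K`
then `(1 + z)^n − 1 ∈ K · I`. [cite: Washington1997, §13.2 (proof of Lemma 13.10)] -/
theorem one_add_pow_sub_one_mem_mul (I K : Ideal R) {n : ℕ} (hn : (n : R) ∈ I) {z : R} (hzK : z ∈ K)
    (hzI : z ∈ I) : (1 + z) ^ n - 1 ∈ K * I := by
  have hgeom : (1 + z) ^ n - 1 = z * ∑ i ∈ Finset.range n, (1 + z) ^ i := by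
    have h := geom_sum_mul (1 + z) n
    rw [add_sub_cancel_left] at h
    rw [← h, mul_comm]
  have hsum : ∑ i ∈ Finset.range n, (1 + z) ^ i ∈ I := by
    have hsplit : ∑ i ∈ Finset.range n, (1 + z) ^ i =
        ∑ i ∈ Finset.range n, ((1 + z) ^ i - 1) + (n : R) := by
      rw [Finset.sum_sub_distrib, Finset.sum_const, Finset.card_range, nsmul_eq_mul, mul_one,
        sub_add_cancel]
    rw [hsplit]
    refine I.add_mem (I.sum_mem fun i _ ↦ ?_) hn
    have hdvd : z ∣ (1 + z) ^ i - 1 := by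
      have := sub_dvd_pow_sub_pow (1 + z) 1 i
      rwa [one_pow, add_sub_cancel_left] at this
    obtain ⟨c, hc⟩ := hdvd
    rw [hc]
    exact I.mul_mem_right c hzI
  rw [hgeom]
  exact Ideal.mul_mem_mul hzK hsum

/-- **`ω_m ∈ I^{m+1}`**: if `p ∈ I` and `y ∈ I` then `(1 + y)^{p^m} − 1 ∈ I^{m+1}` (induction:
`ω_{m+1} = (1 + ω_m)^p − 1 ∈ I^{m+1} · I`). In `Λ = ℤ_p⟦T⟧` with `I = (p, T)`, `y = T`: the layer
polynomials `ω_m = (1+T)^{p^m} − 1` (`Λ/ω_m = ℤ_p[Gal(K_m/K)]`) tend to zero `𝔪`-adically.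
[cite: Washington1997, §13.2 (Lemma 13.10 and the modules `Λ/(ω_n)`)] -/
theorem one_add_pow_pow_sub_one_mem_pow (I : Ideal R) {p : ℕ} (hp : (p : R) ∈ I) {y : R} (hy : y ∈ I)
    (m : ℕ) : (1 + y) ^ (p ^ m) - 1 ∈ I ^ (m + 1) := by
  induction m with
  | zero => simpa using hy
  | succ m ih =>
    have hstep : (1 + y) ^ (p ^ (m + 1)) - 1 = (1 + ((1 + y) ^ (p ^ m) - 1)) ^ p - 1 := by
      rw [add_sub_cancel, pow_succ, pow_mul]
    rw [hstep, pow_succ]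
    refine one_add_pow_sub_one_mem_mul I (I ^ (m + 1)) hp ih ?_
    exact Ideal.pow_le_self (Nat.succ_ne_zero m) ih

end Omega

/-! ### §3 The layer door in `R₀⟦T⟧ = Λ_{R₀}` -/

section UnrSeriesDoor

variable {p : ℕ} [Fact p.Prime]

/-- `(p, T) ⊆ Jac(R₀⟦T⟧)`: `R₀⟦T⟧` is local (the tree's `isLocalRing_unrSeries`) and neither `p` (its
constant term `p` is irreducible in the DVR `R₀`) nor `T` (constant term `0`) is a unit.
[cite: Washington1997, §7.1 (Λ is local with maximal ideal (p, T))] -/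
theorem span_C_sup_span_X_le_jacobson :
    Ideal.span {(PowerSeries.C ((p : ℕ) : unrIntegers p) : UnrSeries p)} ⊔
        Ideal.span {(PowerSeries.X : UnrSeries p)} ≤ (⊥ : Ideal (UnrSeries p)).jacobson := by
  refine sup_le span_C_p_le_jacobson_unrSeries ?_
  haveI := isLocalRing_unrSeries (p := p)
  rw [IsLocalRing.jacobson_eq_maximalIdeal ⊥ bot_ne_top, Ideal.span_le, Set.singleton_subset_iff]
  intro hu
  have h0 := PowerSeries.isUnit_iff_constantCoeff.mp hu
  rw [PowerSeries.constantCoeff_X] at h0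
  exact not_isUnit_zero h0

/-- `p^m ∈ (p, T)^m` and `ω_m = (1+T)^{p^m} − 1 ∈ (p, T)^m` in `R₀⟦T⟧`: the layer ideals `(p^m, ω_m)`
tend to zero `(p, T)`-adically. [cite: Washington1997, §13.2] -/
theorem span_pow_sup_span_omega_le_pow (m : ℕ) :
    Ideal.span {((p : ℕ) : UnrSeries p) ^ m} ⊔
        Ideal.span {((1 + PowerSeries.X) ^ (p ^ m) - 1 : UnrSeries p)} ≤
      (Ideal.span {(PowerSeries.C ((p : ℕ) : unrIntegers p) : UnrSeries p)} ⊔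
        Ideal.span {(PowerSeries.X : UnrSeries p)}) ^ m := by
  set I : Ideal (UnrSeries p) := Ideal.span {(PowerSeries.C ((p : ℕ) : unrIntegers p) : UnrSeries p)} ⊔
    Ideal.span {(PowerSeries.X : UnrSeries p)} with hI
  have hpI : ((p : ℕ) : UnrSeries p) ∈ I := by
    have : ((p : ℕ) : UnrSeries p) = PowerSeries.C ((p : ℕ) : unrIntegers p) := (map_natCast _ p).symm
    rw [this]
    exact Ideal.mem_sup_left (Ideal.mem_span_singleton_self _)
  have hXI : (PowerSeries.X : UnrSeries p) ∈ I := Ideal.mem_sup_right (Ideal.mem_span_singleton_self _)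
  refine sup_le ?_ ?_ <;> rw [Ideal.span_le, Set.singleton_subset_iff, SetLike.mem_coe]
  · exact Ideal.pow_mem_pow hpI m
  · exact Ideal.pow_le_pow_right (Nat.le_succ m) (one_add_pow_pow_sub_one_mem_pow I hpI hXI m)

/-- **The layer door in `R₀⟦T⟧`.** If `x ∈ J + (p^m) + (ω_m)` for every `m ≥ 0`
(`ω_m = (1+T)^{p^m} − 1`), then `x ∈ J`: membership modulo every layer of the `ℤ_p`-tower with
coefficients modulo every power of `p` is membership. [cite: StacksProject, Tag 00IP]
[cite: Washington1997, §13.2] -/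
theorem mem_of_forall_mem_sup_layer (J : Ideal (UnrSeries p)) {x : UnrSeries p}
    (h : ∀ m : ℕ, x ∈ J ⊔ Ideal.span {((p : ℕ) : UnrSeries p) ^ m} ⊔
      Ideal.span {((1 + PowerSeries.X) ^ (p ^ m) - 1 : UnrSeries p)}) : x ∈ J := by
  haveI := isNoetherianRing_unrSeries (p := p)
  exact mem_of_forall_mem_sup_of_le_pow span_C_sup_span_X_le_jacobson J
    (fun m ↦ Ideal.span {((p : ℕ) : UnrSeries p) ^ m} ⊔
      Ideal.span {((1 + PowerSeries.X) ^ (p ^ m) - 1 : UnrSeries p)})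
    (fun n ↦ ⟨n, span_pow_sup_span_omega_le_pow n⟩) (fun m ↦ by simpa only [sup_assoc] using h m)

/-- Ideal form of the layer door: `J' ⊆ J + (p^m) + (ω_m)` for all `m` ⟹ `J' ⊆ J`.
[cite: StacksProject, Tag 00IP] -/
theorem le_of_forall_le_sup_layer (J J' : Ideal (UnrSeries p))
    (h : ∀ m : ℕ, J' ≤ J ⊔ Ideal.span {((p : ℕ) : UnrSeries p) ^ m} ⊔
      Ideal.span {((1 + PowerSeries.X) ^ (p ^ m) - 1 : UnrSeries p)}) : J' ≤ J :=
  fun _ hx ↦ mem_of_forall_mem_sup_layer J fun m ↦ h m hx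

end UnrSeriesDoor

/-! ### §4 By name at the frame of crux K1 / crux A (`p = 3`) -/

section ByName

/-- `(3 : R₀⟦T⟧) = ((3 : ℕ) : R₀⟦T⟧)` — numeral bookkeeping between the route text (`3 ^ μ * L`) and §3.
[folklore] -/
theorem three_eq_natCast : (3 : UnrSeries 3) = ((3 : ℕ) : UnrSeries 3) := by norm_num

/-- **A ⟸ the `Ch`-layer tower.** If at every frame of crux A (= K1's binders) some FIXED power `3^μ`
puts `3^μ · L` into `Ch_Λ(X_{∅,0}(𝔭′))·R₀⟦T⟧ + (3^m) + (ω_m)` for EVERY layer `m`, then the route crux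
`TemperedHeegnerInclusionAtThree` (stmt-26896, = stub A of line `birth`) holds — the layer door
`mem_of_forall_mem_sup_layer`. [cite: MazurTate1987, §1 (theta elements layer by layer)]
[cite: StacksProject, Tag 00IP] -/
theorem temperedHeegnerInclusionAtThree_of_charLayerTower
    (hT : ∀ (W : WeierstrassCurve ℚ) [W.IsElliptic] [W.IsGloballyMinimal] (N : ℕ) [NeZero N] (K : Type) [Field K] [NumberField K] (Dt : Literature.NumberTheory.EllipticCurves.ModularForms.ModularParametrizationData W N), Summit.BirchSwinnertonDyer.Rank1Residual.Additive.ClassO6 W 3 → Literature.NumberTheory.EllipticCurves.Rank1Residual.Red W 3 → (∃ Φ : AddSubgroup (WeierstrassCurve.geomTorsion W ((3 : ℕ) : ℤ)), Literature.NumberTheory.EllipticCurves.Rank1Residual.IsRationalLine W 3 Φ ∧ ∀ (v : IsDedekindDomain.HeightOneSpectrum (NumberField.RingOfIntegers ℚ)), ((3 : ℕ) : NumberField.RingOfIntegers ℚ) ∈ v.asIdeal → ∀ 𝔓 ∈ v.primesAbove, ¬ (∀ g ∈ 𝔓.decompositionSubgroup (Field.absoluteGaloisGroup ℚ), ∀ P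 ∈ Φ, g • P = P) ∧ ¬ (∀ g ∈ 𝔓.decompositionSubgroup (Field.absoluteGaloisGroup ℚ), ∀ P : WeierstrassCurve.geomTorsion W ((3 : ℕ) : ℤ), g • P - P ∈ Φ)) → W.analyticRank = 1 → W.conductorNorm ℤ = N → Literature.NumberTheory.EllipticCurves.IsImaginaryQuadratic K → Literature.NumberTheory.EllipticCurves.SatisfiesHeegnerHypothesis N K → ∀ (κ : Literature.NumberTheory.EllipticCurves.ZpExtension K 3), κ.IsAnticyclotomic → ∀ (γ : Field.absoluteGaloisGroup K) [Fact (κ.IsTopGenerator γ)] (𝔭 : IsDedekindDomain.HeightOneSpectrum (NumberField.RingOfIntegers K)), ((3 : ℕ) : NumberField.RingOfIntegers K) ∈ 𝔭.asIdeal → 𝔭.asIdeal.ramificationIdx (NumberField.RingOfIntegers ℚ) = 1 → 𝔭.asIdeal.inertiaDeg (NumberField.RingOfIntegers ℚ) = 1 → ∀ (𝔭' : IsDedekindDomain.HeightOneSpectrum (NumberField.RingOfIntegers K)), ((3 : ℕ) : NumberField.RingOfIntegers K) ∈ 𝔭'.asIdeal → 𝔭' ≠ 𝔭 → ∀ (ι'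 : PadicAlgCl 3 ≃+* ℂ), Summit.BirchSwinnertonDyer.BirchSwinnertonDyer.Theorems.SchneiderFree.BranchInducesPrime 3 ι' 𝔭 → ∀ (ΩK : ℂ) (Ωp : ℂ_[3]) (L : Literature.NumberTheory.EllipticCurves.UnrSeries 3), ΩK ≠ 0 → Ωp ≠ 0 → Literature.NumberTheory.EllipticCurves.IsBDPLFunction ι' 𝔭 κ γ Dt.f ΩK Ωp L → ∃ μ : ℕ, ∀ m : ℕ, (3 : Literature.NumberTheory.EllipticCurves.UnrSeries 3) ^ μ * L ∈ (Summit.BirchSwinnertonDyer.Rank1Residual.X11b.AcSelmer.XAc.charIdeal (W.baseChange K) 3 κ 𝔭' ∅ γ).map (PowerSeries.map (Summit.BirchSwinnertonDyer.Rank1Residual.X11b.Halves.toUnr 3)) ⊔ Ideal.span {(3 : Literature.NumberTheory.EllipticCurves.UnrSeries 3) ^ m} ⊔ Ideal.span {((1 + PowerSeries.X) ^ (3 ^ m) - 1 : Literature.NumberTheory.EllipticCurves.UnrSeries 3)}) :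
    Summit.BirchSwinnertonDyer.BirchSwinnertonDyer.Theses.CumulativeHeegnerLeopoldt.TemperedHeegnerInclusionAtThree := by
  intro W _ _ N _ K _ _ Dt hO6 hRed hcell hr hN hK hHg κ hκ γ _ 𝔭 h𝔭 he hf 𝔭' h𝔭' hne ι' hι ΩK Ωp L hΩK hΩp hBDP
  obtain ⟨μ, hμ⟩ := hT W N K Dt hO6 hRed hcell hr hN hK hHg κ hκ γ 𝔭 h𝔭 he hf 𝔭' h𝔭' hne ι' hι ΩK Ωp L hΩK hΩp hBDP
  refine ⟨μ, ?_⟩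
  rw [Ideal.span_singleton_le_iff_mem]
  refine mem_of_forall_mem_sup_layer (p := 3) _ fun m ↦ ?_
  rw [← three_eq_natCast]
  exact hμ m

/-- **A ⟺ its `Ch`-layer-tower form** (the converse is trivial: `J ⊆ J + anything`). So lining crux
26896 through layers loses nothing and gains nothing: an honest restatement. [cite: MazurTate1987, §1] -/
theorem temperedHeegnerInclusionAtThree_iff_charLayerTower :
    Summit.BirchSwinnertonDyer.BirchSwinnertonDyer.Theses.CumulativeHeegnerLeopoldt.TemperedHeegnerInclusionAtThree ↔
    (∀ (W : WeierstrassCurve ℚ) [W.IsElliptic] [W.IsGloballyMinimal] (N : ℕ) [NeZero N] (K : Type) [Field K] [NumberField K] (Dt : Literature.NumberTheory.EllipticCurves.ModularForms.ModularParametrizationData W N), Summit.BirchSwinnertonDyer.Rank1Residual.Additive.ClassO6 W 3 → Literature.NumberTheory.EllipticCurves.Rank1Residual.Red W 3 → (∃ Φ : AddSubgroup (WeierstrassCurve.geomTorsion W ((3 : ℕ) : ℤ)), Literature.NumberTheory.EllipticCurves.Rank1Residual.IsRationalLine W 3 Φ ∧ ∀ (v : IsDedekindDomain.HeightOneSpectrum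 (NumberField.RingOfIntegers ℚ)), ((3 : ℕ) : NumberField.RingOfIntegers ℚ) ∈ v.asIdeal → ∀ 𝔓 ∈ v.primesAbove, ¬ (∀ g ∈ 𝔓.decompositionSubgroup (Field.absoluteGaloisGroup ℚ), ∀ P ∈ Φ, g • P = P) ∧ ¬ (∀ g ∈ 𝔓.decompositionSubgroup (Field.absoluteGaloisGroup ℚ), ∀ P : WeierstrassCurve.geomTorsion W ((3 : ℕ) : ℤ), g • P - P ∈ Φ)) → W.analyticRank = 1 → W.conductorNorm ℤ = N → Literature.NumberTheory.EllipticCurves.IsImaginaryQuadratic K → Literature.NumberTheory.EllipticCurves.SatisfiesHeegnerHypothesis N K → ∀ (κ : Literature.NumberTheory.EllipticCurves.ZpExtension K 3), κ.IsAnticyclotomic → ∀ (γ : Field.absoluteGaloisGroup K) [Fact (κ.IsTopGenerator γ)] (𝔭 : IsDedekindDomain.HeightOneSpectrum (NumberField.RingOfIntegers K)), ((3 : ℕ) : NumberField.RingOfIntegers K) ∈ 𝔭.asIdeal → 𝔭.asIdeal.ramificationIdx (NumberField.RingOfIntegers ℚ) = 1 → 𝔭.asIdeal.inertiaDeg (NumberField.RingOfIntegers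 ℚ) = 1 → ∀ (𝔭' : IsDedekindDomain.HeightOneSpectrum (NumberField.RingOfIntegers K)), ((3 : ℕ) : NumberField.RingOfIntegers K) ∈ 𝔭'.asIdeal → 𝔭' ≠ 𝔭 → ∀ (ι' : PadicAlgCl 3 ≃+* ℂ), Summit.BirchSwinnertonDyer.BirchSwinnertonDyer.Theorems.SchneiderFree.BranchInducesPrime 3 ι' 𝔭 → ∀ (ΩK : ℂ) (Ωp : ℂ_[3]) (L : Literature.NumberTheory.EllipticCurves.UnrSeries 3), ΩK ≠ 0 → Ωp ≠ 0 → Literature.NumberTheory.EllipticCurves.IsBDPLFunction ι' 𝔭 κ γ Dt.f ΩK Ωp L → ∃ μ : ℕ, ∀ m : ℕ, (3 : Literature.NumberTheory.EllipticCurves.UnrSeries 3) ^ μ * L ∈ (Summit.BirchSwinnertonDyer.Rank1Residual.X11b.AcSelmer.XAc.charIdeal (W.baseChange K) 3 κ 𝔭' ∅ γ).map (PowerSeries.map (Summit.BirchSwinnertonDyer.Rank1Residual.X11b.Halves.toUnr 3)) ⊔ Ideal.span {(3 : Literature.NumberTheory.EllipticCurves.UnrSeries 3) ^ m} ⊔ Ideal.span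 {((1 + PowerSeries.X) ^ (3 ^ m) - 1 : Literature.NumberTheory.EllipticCurves.UnrSeries 3)}) := by
  refine ⟨fun hA ↦ ?_, temperedHeegnerInclusionAtThree_of_charLayerTower⟩
  intro W _ _ N _ K _ _ Dt hO6 hRed hcell hr hN hK hHg κ hκ γ _ 𝔭 h𝔭 he hf 𝔭' h𝔭' hne ι' hι ΩK Ωp L hΩK hΩp hBDP
  obtain ⟨μ, hμ⟩ := hA W N K Dt hO6 hRed hcell hr hN hK hHg κ hκ γ 𝔭 h𝔭 he hf 𝔭' h𝔭' hne ι' hι ΩK Ωp L hΩK hΩp hBDP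
  rw [Ideal.span_singleton_le_iff_mem] at hμ
  exact ⟨μ, fun m ↦ Ideal.mem_sup_left (Ideal.mem_sup_left hμ)⟩

/-- **`Fitt_Λ(X)·R₀⟦T⟧ ⊆ Ch_Λ(X)·R₀⟦T⟧`** for Castella's anticyclotomic Selmer dual `X = X_ac^∅(𝔮)` of any
elliptic curve over a number field (a finitely generated `Λ`-module, tree `XAc.module_finite_empty`;
`Fitt₀ ⊆ Ch` over the Noetherian UFD `Λ = ℤ_p⟦T⟧`, Skinner–Urban §3.1.6; off the torsion locus both
readings are harmless: `Fitt = 0`). [cite: SkinnerUrban2014, §3.1.6 (p. 20) and Cor. 3.2.9] -/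
theorem map_fittingIdeal_le_map_charIdeal {K : Type u} [Field K] [NumberField K]
    (E : WeierstrassCurve K) [E.IsElliptic] (p : ℕ) [Fact p.Prime] (κ : ZpExtension K p)
    (𝔮 : HeightOneSpectrum (𝓞 K)) (γ : absoluteGaloisGroup K) [Fact (κ.IsTopGenerator γ)]
    {S : Type*} [CommRing S] (φ : IwasawaAlgebra p →+* S) :
    (Literature.RingTheory.FittingIdeal.Module.fittingIdeal (IwasawaAlgebra p) (XAc E p κ 𝔮 ∅ γ) 0).map φ ≤
      (XAc.charIdeal E p κ 𝔮 ∅ γ).map φ := by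
  haveI : Module.Finite (IwasawaAlgebra p) (XAc E p κ 𝔮 ∅ γ) := XAc.module_finite_empty κ 𝔮 γ
  exact Ideal.map_mono
    (Literature.NumberTheory.EllipticCurves.SkinnerUrban2014.fittingIdeal_zero_le_charIdeal
      (R := IwasawaAlgebra p) (M := XAc E p κ 𝔮 ∅ γ))

/-- **(LT) ⟹ A: the FITTING layer tower closes crux A.** If at every frame some fixed `3^μ` puts
`3^μ · L` into `Fitt_Λ(X_{∅,0}(𝔭′))·R₀⟦T⟧ + (3^m) + (ω_m)` for every layer `m` — the natural end of a
layer-by-layer equivariant Euler-system argument with finite coefficients `ℤ/3^k[Gal(K_m/K)]` followed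
by control and a layer reciprocity, with an `m`-UNIFORM `3`-power loss — then
`TemperedHeegnerInclusionAtThree` holds (`Fitt ⊆ Ch` + the layer door). Nothing about the existence of
such an argument at additive `3` is asserted. [cite: KimKurihara2021, §1 (Fitting ideals of Selmer groups over layer group rings)]
[cite: BertoliniDarmon1990, §2 (Kolyvagin's descent over ring class fields)] [cite: SkinnerUrban2014, §3.1.6] -/
theorem temperedHeegnerInclusionAtThree_of_fittingLayerTower
    (hLT : ∀ (W : WeierstrassCurve ℚ) [W.IsElliptic] [W.IsGloballyMinimal] (N : ℕ) [NeZero N] (K : Type) [Field K] [NumberField K] (Dt : Literature.NumberTheory.EllipticCurves.ModularForms.ModularParametrizationData W N), Summit.BirchSwinnertonDyer.Rank1Residual.Additive.ClassO6 W 3 → Literature.NumberTheory.EllipticCurves.Rank1Residual.Red W 3 → (∃ Φ : AddSubgroup (WeierstrassCurve.geomTorsion W ((3 : ℕ) : ℤ)), Literature.NumberTheory.EllipticCurves.Rank1Residual.IsRationalLine W 3 Φ ∧ ∀ (v : IsDedekindDomain.HeightOneSpectrum (NumberField.RingOfIntegers ℚ)), ((3 : ℕ) : NumberField.RingOfIntegers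 ℚ) ∈ v.asIdeal → ∀ 𝔓 ∈ v.primesAbove, ¬ (∀ g ∈ 𝔓.decompositionSubgroup (Field.absoluteGaloisGroup ℚ), ∀ P ∈ Φ, g • P = P) ∧ ¬ (∀ g ∈ 𝔓.decompositionSubgroup (Field.absoluteGaloisGroup ℚ), ∀ P : WeierstrassCurve.geomTorsion W ((3 : ℕ) : ℤ), g • P - P ∈ Φ)) → W.analyticRank = 1 → W.conductorNorm ℤ = N → Literature.NumberTheory.EllipticCurves.IsImaginaryQuadratic K → Literature.NumberTheory.EllipticCurves.SatisfiesHeegnerHypothesis N K → ∀ (κ : Literature.NumberTheory.EllipticCurves.ZpExtension K 3), κ.IsAnticyclotomic → ∀ (γ : Field.absoluteGaloisGroup K) [Fact (κ.IsTopGenerator γ)] (𝔭 : IsDedekindDomain.HeightOneSpectrum (NumberField.RingOfIntegers K)), ((3 : ℕ) : NumberField.RingOfIntegers K) ∈ 𝔭.asIdeal → 𝔭.asIdeal.ramificationIdx (NumberField.RingOfIntegers ℚ) = 1 → 𝔭.asIdeal.inertiaDeg (NumberField.RingOfIntegers ℚ) = 1 → ∀ (𝔭' : IsDedekindDomain.HeightOneSpectrum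 (NumberField.RingOfIntegers K)), ((3 : ℕ) : NumberField.RingOfIntegers K) ∈ 𝔭'.asIdeal → 𝔭' ≠ 𝔭 → ∀ (ι' : PadicAlgCl 3 ≃+* ℂ), Summit.BirchSwinnertonDyer.BirchSwinnertonDyer.Theorems.SchneiderFree.BranchInducesPrime 3 ι' 𝔭 → ∀ (ΩK : ℂ) (Ωp : ℂ_[3]) (L : Literature.NumberTheory.EllipticCurves.UnrSeries 3), ΩK ≠ 0 → Ωp ≠ 0 → Literature.NumberTheory.EllipticCurves.IsBDPLFunction ι' 𝔭 κ γ Dt.f ΩK Ωp L → ∃ μ : ℕ, ∀ m : ℕ, (3 : Literature.NumberTheory.EllipticCurves.UnrSeries 3) ^ μ * L ∈ (Literature.RingTheory.FittingIdeal.Module.fittingIdeal (Literature.NumberTheory.EllipticCurves.IwasawaAlgebra 3) (Summit.BirchSwinnertonDyer.Rank1Residual.X11b.AcSelmer.XAc (W.baseChange K) 3 κ 𝔭' ∅ γ) 0).map (PowerSeries.map (Summit.BirchSwinnertonDyer.Rank1Residual.X11b.Halves.toUnr 3)) ⊔ Ideal.span {(3 : Literature.NumberTheory.EllipticCurves.UnrSeries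 3) ^ m} ⊔ Ideal.span {((1 + PowerSeries.X) ^ (3 ^ m) - 1 : Literature.NumberTheory.EllipticCurves.UnrSeries 3)}) :
    Summit.BirchSwinnertonDyer.BirchSwinnertonDyer.Theses.CumulativeHeegnerLeopoldt.TemperedHeegnerInclusionAtThree := by
  refine temperedHeegnerInclusionAtThree_of_charLayerTower ?_
  intro W _ _ N _ K _ _ Dt hO6 hRed hcell hr hN hK hHg κ hκ γ _ 𝔭 h𝔭 he hf 𝔭' h𝔭' hne ι' hι ΩK Ωp L hΩK hΩp hBDP
  haveI : (W.baseChange K).IsElliptic := inferInstanceAs (W.map (algebraMap ℚ K)).IsElliptic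
  obtain ⟨μ, hμ⟩ := hLT W N K Dt hO6 hRed hcell hr hN hK hHg κ hκ γ 𝔭 h𝔭 he hf 𝔭' h𝔭' hne ι' hι ΩK Ωp L hΩK hΩp hBDP
  refine ⟨μ, fun m ↦ ?_⟩
  have hle := sup_le_sup_right (sup_le_sup_right
    (map_fittingIdeal_le_map_charIdeal (W.baseChange K) 3 κ 𝔭' γ
      (PowerSeries.map (Summit.BirchSwinnertonDyer.Rank1Residual.X11b.Halves.toUnr 3)))
    (Ideal.span {(3 : UnrSeries 3) ^ m})) (Ideal.span {((1 + PowerSeries.X) ^ (3 ^ m) - 1 : UnrSeries 3)})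
  exact hle (hμ m)

/-- **K1 ⟸ P ∧ (LT)** by name: the print input P (`ResidualSelmerPrintedInputAtThree` = CGLS22
Prop. 14) and the Fitting layer tower give the route crux `CumulativeHeegnerInclusionAtThree` — (LT) ⟹ A
(`temperedHeegnerInclusionAtThree_of_fittingLayerTower`); P ⟹ B1 (`…B1OfPrint.stub_residualSelmerFinite_of_print`
with p614633/p613929, the content of the 26898 closer) ⟹ the image ideal is `span{g}` with a norm-one
coefficient (UTD Greenberg criterion) ⟹ saturation at `3` (`stub_threeSaturation`'s lemma) removes `3^μ`.
Route-independent modules only (no glue file is imported).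
[cite: CastellaGrossiLeeSkinner2022, §1.2 Prop. 14 (arXiv:2008.02571)] [cite: MazurTate1987, §1] -/
theorem cumulativeHeegnerInclusionAtThree_of_print_of_fittingLayerTower
    (hP : Summit.BirchSwinnertonDyer.BirchSwinnertonDyer.Theses.CumulativeHeegnerLeopoldt.ResidualSelmerPrintedInputAtThree)
    (hLT : ∀ (W : WeierstrassCurve ℚ) [W.IsElliptic] [W.IsGloballyMinimal] (N : ℕ) [NeZero N] (K : Type) [Field K] [NumberField K] (Dt : Literature.NumberTheory.EllipticCurves.ModularForms.ModularParametrizationData W N), Summit.BirchSwinnertonDyer.Rank1Residual.Additive.ClassO6 W 3 → Literature.NumberTheory.EllipticCurves.Rank1Residual.Red W 3 → (∃ Φ : AddSubgroup (WeierstrassCurve.geomTorsion W ((3 : ℕ) : ℤ)), Literature.NumberTheory.EllipticCurves.Rank1Residual.IsRationalLine W 3 Φ ∧ ∀ (v : IsDedekindDomain.HeightOneSpectrum (NumberField.RingOfIntegers ℚ)), ((3 : ℕ) : NumberField.RingOfIntegers ℚ) ∈ v.asIdeal → ∀ 𝔓 ∈ v.primesAbove, ¬ (∀ g ∈ 𝔓.decompositionSubgroup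 (Field.absoluteGaloisGroup ℚ), ∀ P ∈ Φ, g • P = P) ∧ ¬ (∀ g ∈ 𝔓.decompositionSubgroup (Field.absoluteGaloisGroup ℚ), ∀ P : WeierstrassCurve.geomTorsion W ((3 : ℕ) : ℤ), g • P - P ∈ Φ)) → W.analyticRank = 1 → W.conductorNorm ℤ = N → Literature.NumberTheory.EllipticCurves.IsImaginaryQuadratic K → Literature.NumberTheory.EllipticCurves.SatisfiesHeegnerHypothesis N K → ∀ (κ : Literature.NumberTheory.EllipticCurves.ZpExtension K 3), κ.IsAnticyclotomic → ∀ (γ : Field.absoluteGaloisGroup K) [Fact (κ.IsTopGenerator γ)] (𝔭 : IsDedekindDomain.HeightOneSpectrum (NumberField.RingOfIntegers K)), ((3 : ℕ) : NumberField.RingOfIntegers K) ∈ 𝔭.asIdeal → 𝔭.asIdeal.ramificationIdx (NumberField.RingOfIntegers ℚ) = 1 → 𝔭.asIdeal.inertiaDeg (NumberField.RingOfIntegers ℚ) = 1 → ∀ (𝔭' : IsDedekindDomain.HeightOneSpectrum (NumberField.RingOfIntegers K)), ((3 : ℕ) : NumberField.RingOfIntegers K) ∈ 𝔭'.asIdeal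 → 𝔭' ≠ 𝔭 → ∀ (ι' : PadicAlgCl 3 ≃+* ℂ), Summit.BirchSwinnertonDyer.BirchSwinnertonDyer.Theorems.SchneiderFree.BranchInducesPrime 3 ι' 𝔭 → ∀ (ΩK : ℂ) (Ωp : ℂ_[3]) (L : Literature.NumberTheory.EllipticCurves.UnrSeries 3), ΩK ≠ 0 → Ωp ≠ 0 → Literature.NumberTheory.EllipticCurves.IsBDPLFunction ι' 𝔭 κ γ Dt.f ΩK Ωp L → ∃ μ : ℕ, ∀ m : ℕ, (3 : Literature.NumberTheory.EllipticCurves.UnrSeries 3) ^ μ * L ∈ (Literature.RingTheory.FittingIdeal.Module.fittingIdeal (Literature.NumberTheory.EllipticCurves.IwasawaAlgebra 3) (Summit.BirchSwinnertonDyer.Rank1Residual.X11b.AcSelmer.XAc (W.baseChange K) 3 κ 𝔭' ∅ γ) 0).map (PowerSeries.map (Summit.BirchSwinnertonDyer.Rank1Residual.X11b.Halves.toUnr 3)) ⊔ Ideal.span {(3 : Literature.NumberTheory.EllipticCurves.UnrSeries 3) ^ m} ⊔ Ideal.span {((1 + PowerSeries.X) ^ (3 ^ m) - 1 : Literature.NumberTheory.EllipticCurves.UnrSeries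 3)}) :
    Summit.BirchSwinnertonDyer.BirchSwinnertonDyer.Theses.CumulativeHeegnerLeopoldt.CumulativeHeegnerInclusionAtThree := by
  have hA := temperedHeegnerInclusionAtThree_of_fittingLayerTower hLT
  intro W _ _ N _ K _ _ Dt hO6 hRed hcell hr hN hK hHg κ hκ γ _ 𝔭 h𝔭 he hf 𝔭' h𝔭' hne ι' hι ΩK Ωp L hΩK hΩp hBDP
  haveI : (W.baseChange K).IsElliptic := inferInstanceAs (W.map (algebraMap ℚ K)).IsElliptic
  -- B1 from print (the three inputs of the landed 26898 closer, route-independent modules)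
  have hfin :=
    Summit.BirchSwinnertonDyer.BirchSwinnertonDyer.Theorems.CumulativeHeegnerInclusionAtThreeB1OfPrint.stub_residualSelmerFinite_of_print
      hP
      Summit.BirchSwinnertonDyer.BirchSwinnertonDyer.Theorems.CumulativeHeegnerInclusionAtThreeLineDet.stub_lineDeterminantAtThree
      Summit.BirchSwinnertonDyer.BirchSwinnertonDyer.Theorems.CumulativeHeegnerInclusionAtThreeBadPlaces.stub_badPlacesSplitFinite
      W N K hO6 hRed hcell hN hK hHg κ hκ 𝔭' h𝔭'
  obtain ⟨_, g, hg, n, hn⟩ :=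
    Summit.BirchSwinnertonDyer.BirchSwinnertonDyer.Theorems.UniversalToricDescentAcDualMuZero.isTorsion_and_exists_generator_of_finite_pTorsion
      (W.baseChange K) 3 κ 𝔭' ∅ γ Set.finite_empty hfin
  obtain ⟨μ, hμ⟩ := hA W N K Dt hO6 hRed hcell hr hN hK hHg κ hκ γ 𝔭 h𝔭 he hf 𝔭' h𝔭' hne ι' hι ΩK Ωp L hΩK hΩp hBDP
  rw [hg] at hμ ⊢
  exact Summit.BirchSwinnertonDyer.BirchSwinnertonDyer.Theorems.CumulativeHeegnerInclusionAtThreeSaturation.span_le_span_of_span_pow_three_mul_le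
    L g μ n hn hμ

/-- **K1 ⟸ the INTEGRAL `Ch`-layer tower, print-free.** If at every frame `L ∈ Ch_Λ(X)·R₀⟦T⟧ + (3^m) +
(ω_m)` for every layer `m` (no `3^μ`), the route crux `CumulativeHeegnerInclusionAtThree` holds outright —
no print input, no saturation: the layer door alone. [cite: StacksProject, Tag 00IP] [cite: MazurTate1987, §1] -/
theorem cumulativeHeegnerInclusionAtThree_of_integralCharLayerTower
    (hT : ∀ (W : WeierstrassCurve ℚ) [W.IsElliptic] [W.IsGloballyMinimal] (N : ℕ) [NeZero N] (K : Type) [Field K] [NumberField K] (Dt : Literature.NumberTheory.EllipticCurves.ModularForms.ModularParametrizationData W N), Summit.BirchSwinnertonDyer.Rank1Residual.Additive.ClassO6 W 3 → Literature.NumberTheory.EllipticCurves.Rank1Residual.Red W 3 → (∃ Φ : AddSubgroup (WeierstrassCurve.geomTorsion W ((3 : ℕ) : ℤ)), Literature.NumberTheory.EllipticCurves.Rank1Residual.IsRationalLine W 3 Φ ∧ ∀ (v : IsDedekindDomain.HeightOneSpectrum (NumberField.RingOfIntegers ℚ)), ((3 : ℕ) : NumberField.RingOfIntegers ℚ) ∈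 v.asIdeal → ∀ 𝔓 ∈ v.primesAbove, ¬ (∀ g ∈ 𝔓.decompositionSubgroup (Field.absoluteGaloisGroup ℚ), ∀ P ∈ Φ, g • P = P) ∧ ¬ (∀ g ∈ 𝔓.decompositionSubgroup (Field.absoluteGaloisGroup ℚ), ∀ P : WeierstrassCurve.geomTorsion W ((3 : ℕ) : ℤ), g • P - P ∈ Φ)) → W.analyticRank = 1 → W.conductorNorm ℤ = N → Literature.NumberTheory.EllipticCurves.IsImaginaryQuadratic K → Literature.NumberTheory.EllipticCurves.SatisfiesHeegnerHypothesis N K → ∀ (κ : Literature.NumberTheory.EllipticCurves.ZpExtension K 3), κ.IsAnticyclotomic → ∀ (γ : Field.absoluteGaloisGroup K) [Fact (κ.IsTopGenerator γ)] (𝔭 : IsDedekindDomain.HeightOneSpectrum (NumberField.RingOfIntegers K)), ((3 : ℕ) : NumberField.RingOfIntegers K) ∈ 𝔭.asIdeal → 𝔭.asIdeal.ramificationIdx (NumberField.RingOfIntegers ℚ) = 1 → 𝔭.asIdeal.inertiaDeg (NumberField.RingOfIntegers ℚ) = 1 → ∀ (𝔭' : IsDedekindDomain.HeightOneSpectrum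 (NumberField.RingOfIntegers K)), ((3 : ℕ) : NumberField.RingOfIntegers K) ∈ 𝔭'.asIdeal → 𝔭' ≠ 𝔭 → ∀ (ι' : PadicAlgCl 3 ≃+* ℂ), Summit.BirchSwinnertonDyer.BirchSwinnertonDyer.Theorems.SchneiderFree.BranchInducesPrime 3 ι' 𝔭 → ∀ (ΩK : ℂ) (Ωp : ℂ_[3]) (L : Literature.NumberTheory.EllipticCurves.UnrSeries 3), ΩK ≠ 0 → Ωp ≠ 0 → Literature.NumberTheory.EllipticCurves.IsBDPLFunction ι' 𝔭 κ γ Dt.f ΩK Ωp L → ∀ m : ℕ, L ∈ (Summit.BirchSwinnertonDyer.Rank1Residual.X11b.AcSelmer.XAc.charIdeal (W.baseChange K) 3 κ 𝔭' ∅ γ).map (PowerSeries.map (Summit.BirchSwinnertonDyer.Rank1Residual.X11b.Halves.toUnr 3)) ⊔ Ideal.span {(3 : Literature.NumberTheory.EllipticCurves.UnrSeries 3) ^ m} ⊔ Ideal.span {((1 + PowerSeries.X) ^ (3 ^ m) - 1 : Literature.NumberTheory.EllipticCurves.UnrSeries 3)}) :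
    Summit.BirchSwinnertonDyer.BirchSwinnertonDyer.Theses.CumulativeHeegnerLeopoldt.CumulativeHeegnerInclusionAtThree := by
  intro W _ _ N _ K _ _ Dt hO6 hRed hcell hr hN hK hHg κ hκ γ _ 𝔭 h𝔭 he hf 𝔭' h𝔭' hne ι' hι ΩK Ωp L hΩK hΩp hBDP
  rw [Ideal.span_singleton_le_iff_mem]
  refine mem_of_forall_mem_sup_layer (p := 3) _ fun m ↦ ?_
  rw [← three_eq_natCast]
  exact hT W N K Dt hO6 hRed hcell hr hN hK hHg κ hκ γ 𝔭 h𝔭 he hf 𝔭' h𝔭' hne ι' hι ΩK Ωp L hΩK hΩp hBDP m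

/-- **K1 ⟺ its integral `Ch`-layer-tower form** (converse trivial). [cite: MazurTate1987, §1] -/
theorem cumulativeHeegnerInclusionAtThree_iff_integralCharLayerTower :
    Summit.BirchSwinnertonDyer.BirchSwinnertonDyer.Theses.CumulativeHeegnerLeopoldt.CumulativeHeegnerInclusionAtThree ↔
    (∀ (W : WeierstrassCurve ℚ) [W.IsElliptic] [W.IsGloballyMinimal] (N : ℕ) [NeZero N] (K : Type) [Field K] [NumberField K] (Dt : Literature.NumberTheory.EllipticCurves.ModularForms.ModularParametrizationData W N), Summit.BirchSwinnertonDyer.Rank1Residual.Additive.ClassO6 W 3 → Literature.NumberTheory.EllipticCurves.Rank1Residual.Red W 3 → (∃ Φ : AddSubgroup (WeierstrassCurve.geomTorsion W ((3 : ℕ) : ℤ)), Literature.NumberTheory.EllipticCurves.Rank1Residual.IsRationalLine W 3 Φ ∧ ∀ (v : IsDedekindDomain.HeightOneSpectrum (NumberField.RingOfIntegers ℚ)), ((3 : ℕ) : NumberField.RingOfIntegers ℚ) ∈ v.asIdeal → ∀ 𝔓 ∈ v.primesAbove, ¬ (∀ g ∈ 𝔓.decompositionSubgroup (Field.absoluteGaloisGroup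 ℚ), ∀ P ∈ Φ, g • P = P) ∧ ¬ (∀ g ∈ 𝔓.decompositionSubgroup (Field.absoluteGaloisGroup ℚ), ∀ P : WeierstrassCurve.geomTorsion W ((3 : ℕ) : ℤ), g • P - P ∈ Φ)) → W.analyticRank = 1 → W.conductorNorm ℤ = N → Literature.NumberTheory.EllipticCurves.IsImaginaryQuadratic K → Literature.NumberTheory.EllipticCurves.SatisfiesHeegnerHypothesis N K → ∀ (κ : Literature.NumberTheory.EllipticCurves.ZpExtension K 3), κ.IsAnticyclotomic → ∀ (γ : Field.absoluteGaloisGroup K) [Fact (κ.IsTopGenerator γ)] (𝔭 : IsDedekindDomain.HeightOneSpectrum (NumberField.RingOfIntegers K)), ((3 : ℕ) : NumberField.RingOfIntegers K) ∈ 𝔭.asIdeal → 𝔭.asIdeal.ramificationIdx (NumberField.RingOfIntegers ℚ) = 1 → 𝔭.asIdeal.inertiaDeg (NumberField.RingOfIntegers ℚ) = 1 → ∀ (𝔭' : IsDedekindDomain.HeightOneSpectrum (NumberField.RingOfIntegers K)), ((3 : ℕ) : NumberField.RingOfIntegers K) ∈ 𝔭'.asIdeal → 𝔭' ≠ 𝔭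 → ∀ (ι' : PadicAlgCl 3 ≃+* ℂ), Summit.BirchSwinnertonDyer.BirchSwinnertonDyer.Theorems.SchneiderFree.BranchInducesPrime 3 ι' 𝔭 → ∀ (ΩK : ℂ) (Ωp : ℂ_[3]) (L : Literature.NumberTheory.EllipticCurves.UnrSeries 3), ΩK ≠ 0 → Ωp ≠ 0 → Literature.NumberTheory.EllipticCurves.IsBDPLFunction ι' 𝔭 κ γ Dt.f ΩK Ωp L → ∀ m : ℕ, L ∈ (Summit.BirchSwinnertonDyer.Rank1Residual.X11b.AcSelmer.XAc.charIdeal (W.baseChange K) 3 κ 𝔭' ∅ γ).map (PowerSeries.map (Summit.BirchSwinnertonDyer.Rank1Residual.X11b.Halves.toUnr 3)) ⊔ Ideal.span {(3 : Literature.NumberTheory.EllipticCurves.UnrSeries 3) ^ m} ⊔ Ideal.span {((1 + PowerSeries.X) ^ (3 ^ m) - 1 : Literature.NumberTheory.EllipticCurves.UnrSeries 3)}) := by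
  refine ⟨fun hK1 ↦ ?_, cumulativeHeegnerInclusionAtThree_of_integralCharLayerTower⟩
  intro W _ _ N _ K _ _ Dt hO6 hRed hcell hr hN hK hHg κ hκ γ _ 𝔭 h𝔭 he hf 𝔭' h𝔭' hne ι' hι ΩK Ωp L hΩK hΩp hBDP
    m
  have h := hK1 W N K Dt hO6 hRed hcell hr hN hK hHg κ hκ γ 𝔭 h𝔭 he hf 𝔭' h𝔭' hne ι' hι ΩK Ωp L hΩK hΩp hBDP
  rw [Ideal.span_singleton_le_iff_mem] at h
  exact Ideal.mem_sup_left (Ideal.mem_sup_left h)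

end ByName

end Summit.BirchSwinnertonDyer.BirchSwinnertonDyer.Theorems.CumulativeHeegnerInclusionAtThreeLayerTower

end
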